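import Literature.NumberTheory.EllipticCurves.JetchevSkinnerWan2017.SigmaLocalFinitelyDecomposedFiniteProofs
import Literature.NumberTheory.EllipticCurves.InertiaInvariantsPrimaryTorsionAdditiveProofs
import Literature.NumberTheory.EllipticCurves.InertiaCohomologyPrimaryTorsionFiniteProofs
import HarnessLib

/-!
# The local `Σ`-atom at the places of ADDITIVE reduction (finitely decomposed, `c ≠ 0`):
# the three conjuncts, UNCONDITIONALLY

Topic `Literature/NumberTheory/EllipticCurves/JetchevSkinnerWan2017` (sibling of the named LOCAL fact
`sigmaLocal_charIdeal_eulerFactor_mem_of_noTamagawaDefect`). THEOREMS ONLY (no definition, no named fact,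
no `sorry`). Cell `bsd-stepL`, K2 support 20495 `JSWSigmaLocalCharIdeal`, module L5; seat `bsd-stepL-imc-p1` g13.

Assembly of three theorems of the tree:

* `sigmaLocal_of_ne_zero_of_finite_inertia` (`SigmaLocalFinitelyDecomposedFiniteProofs`): at a finitely
  decomposed `w ∤ p` (`c ≠ 0`), IF `E[p^∞]^{I_w}` and `H¹(I_w, E[p^∞])` are finite then the dual `X_w` of
  `H¹(K_w, T_pE ⊗ Λ^*(Ψ⁻¹))` is finitely generated and torsion over `Λ` with `Ch_Λ(X_w) = ⊤`;
* `WeierstrassCurve.finite_setOf_primaryTorsionGaloisRep_localMap_fixed_of_hasAdditiveReductionAt`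
  (`InertiaInvariantsPrimaryTorsionAdditiveProofs`): `E[p^∞]^{I_w}` is finite at an additive `w ∤ p`
  (Silverman *ATAEC* IV.10.2(a), additive case, on `E[p^∞]`; Kodaira–Néron exponent + cusp);
* `WeierstrassCurve.finite_h1_absInertia_primaryTorsion_of_finite_fixed`
  (`InertiaCohomologyPrimaryTorsionFiniteProofs`): then `H¹(I_w, E[p^∞])` is finite (tame structure of
  `I_w`, Serre *Local Fields* IV §2 / XIII §1).

Results:

* `sigmaLocal_of_ne_zero_of_hasAdditiveReductionAt` — the three conjuncts of the atom at a finitely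
  decomposed place of additive reduction, for ANY reduction datum `t` carried by the Euler datum;
* `sigmaLocal_additive_of_ne_zero` — the same for the additive datum `t = .additive` (the reduction type is
  read off `IsEulerDataAt`), where `eulerFactor p ℤ_[p] Nw .additive c = 1`.

After this file the `c ≠ 0` half of the atom is open exactly at the finitely decomposed places of GOOD
and MULTIPLICATIVE reduction (infinite `E[p^∞]^{I_w}`: the `Λ`-structure route through
`BigRepLocalTermFrameProofs` ∕ `BigRepShiftedEndomorphismModelsProofs`).

References: [GreenbergVatsal2000] §2, proof of Prop. 2.4 (additive primes); [Skinner2016PacificMC] §2.3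
(p. 180, `P_ℓ = 1` at additive `ℓ`); [JetchevSkinnerWan2017] proof of Thm. 6.1.6; [SilvermanATAEC1994]
Thm. IV.10.2(a); [SerreLocalFields1979] IV §2, XIII §1.
-/

noncomputable section

open scoped Classical

open Field NumberField IsDedekindDomain WeierstrassCurve
open Literature.NumberTheory.EllipticCurves Literature.NumberTheory.GaloisRepresentations
  Literature.NumberTheory.EllipticCurves.BigGaloisRep Literature.NumberTheory.EllipticCurves.IwasawaCharacter

namespace Literature.NumberTheory.EllipticCurves.JetchevSkinnerWan2017

/-- **The local `Σ`-atom at a finitely decomposed place of ADDITIVE reduction, unconditionally**: for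
`E` elliptic over a number field `K : Type`, a prime `p`, a `ℤ_p`-extension `κ`, a finite place `w ∤ p`
of additive reduction with Euler datum `(Nw, t, c)`, `c ≠ 0`, the Pontryagin dual of
`H¹(K_w, T_pE ⊗ Λ^*(Ψ⁻¹))` is finitely generated and torsion over `Λ` and its characteristic ideal
contains `eulerFactor p ℤ_[p] Nw t c` (indeed it is `⊤`).
[cite: GreenbergVatsal2000, §2, proof of Prop. 2.4 (additive primes: `E[p^∞]^{I_ℓ}` finite, `𝓗_ℓ = 0`)]
[cite: Skinner2016PacificMC, §2.3 (p. 180)] [cite: SilvermanATAEC1994, Thm. IV.10.2(a), additive case] -/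
theorem sigmaLocal_of_ne_zero_of_hasAdditiveReductionAt {K : Type} [Field K] [NumberField K]
    (E : WeierstrassCurve K) [E.IsElliptic] (p : ℕ) [Fact p.Prime] (κ : ZpExtension K p)
    (w : HeightOneSpectrum (𝓞 K)) (hw : ((p : ℕ) : 𝓞 K) ∉ w.asIdeal)
    (Nw : ℕ) (t : LocalReductionData) (c : ℤ_[p]) (hdata : IsEulerDataAt E κ w Nw t c) (hc : c ≠ 0)
    (hadd : E.HasAdditiveReductionAt w)
    [ContinuousSMul ℤ_[p] (PrimaryTorsion (geomPoints E) p)]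
    [TopologicalSpace (IwasawaAlgebra p)]
    [ContinuousSMul (IwasawaAlgebra p) (BigRepModule ℤ_[p] p (PrimaryTorsion (geomPoints E) p))] :
    Module.Finite (IwasawaAlgebra p) (CharacterModule (continuousCohomology 1
        ((AnticyclotomicBigGaloisRep κ (E.primaryTorsionGaloisRep p)).restrict
          (localMap K (Sum.inl w))).toTopRep)) ∧
      Module.IsTorsion (IwasawaAlgebra p) (CharacterModule (continuousCohomology 1
        ((AnticyclotomicBigGaloisRep κ (E.primaryTorsionGaloisRep p)).restrict
          (localMap K (Sum.inl w))).toTopRep)) ∧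
      eulerFactor p ℤ_[p] Nw t c ∈ Module.charIdeal (IwasawaAlgebra p) (CharacterModule
        (continuousCohomology 1
          ((AnticyclotomicBigGaloisRep κ (E.primaryTorsionGaloisRep p)).restrict
            (localMap K (Sum.inl w))).toTopRep)) :=
  have hfinI := E.finite_setOf_primaryTorsionGaloisRep_localMap_fixed_of_hasAdditiveReductionAt p hw hadd
  sigmaLocal_of_ne_zero_of_finite_inertia E p κ w hw Nw t c hdata hc hfinI
    (E.finite_h1_absInertia_primaryTorsion_of_finite_fixed p hw hfinI)

/-- **The local `Σ`-atom for the ADDITIVE reduction datum at a finitely decomposed place**: with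
`t = .additive` the Euler datum itself records `E.HasAdditiveReductionAt w`, and the three conjuncts hold
(here `eulerFactor p ℤ_[p] Nw .additive c = 1`). [cite: Skinner2016PacificMC, §2.3 (p. 180, `P_ℓ(X) = 1` at additive `ℓ`)]
[cite: GreenbergVatsal2000, §2, proof of Prop. 2.4] -/
theorem sigmaLocal_additive_of_ne_zero {K : Type} [Field K] [NumberField K]
    (E : WeierstrassCurve K) [E.IsElliptic] (p : ℕ) [Fact p.Prime] (κ : ZpExtension K p)
    (w : HeightOneSpectrum (𝓞 K)) (hw : ((p : ℕ) : 𝓞 K) ∉ w.asIdeal)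
    (Nw : ℕ) (c : ℤ_[p]) (hdata : IsEulerDataAt E κ w Nw .additive c) (hc : c ≠ 0)
    [ContinuousSMul ℤ_[p] (PrimaryTorsion (geomPoints E) p)]
    [TopologicalSpace (IwasawaAlgebra p)]
    [ContinuousSMul (IwasawaAlgebra p) (BigRepModule ℤ_[p] p (PrimaryTorsion (geomPoints E) p))] :
    Module.Finite (IwasawaAlgebra p) (CharacterModule (continuousCohomology 1
        ((AnticyclotomicBigGaloisRep κ (E.primaryTorsionGaloisRep p)).restrict
          (localMap K (Sum.inl w))).toTopRep)) ∧
      Module.IsTorsion (IwasawaAlgebra p) (CharacterModule (continuousCohomology 1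
        ((AnticyclotomicBigGaloisRep κ (E.primaryTorsionGaloisRep p)).restrict
          (localMap K (Sum.inl w))).toTopRep)) ∧
      eulerFactor p ℤ_[p] Nw .additive c ∈ Module.charIdeal (IwasawaAlgebra p) (CharacterModule
        (continuousCohomology 1
          ((AnticyclotomicBigGaloisRep κ (E.primaryTorsionGaloisRep p)).restrict
            (localMap K (Sum.inl w))).toTopRep)) :=
  sigmaLocal_of_ne_zero_of_hasAdditiveReductionAt E p κ w hw Nw .additive c hdata hc hdata.2.2

end Literature.NumberTheory.EllipticCurves.JetchevSkinnerWan2017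

end
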